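import Summits.ResolutionOfSingularities.ResolutionOfSingularities.Theorems.IsoDict2
import Summits.ResolutionOfSingularities.ResolutionOfSingularities.Theorems.ThreadCutJunction
import HarnessLib

/-!
# TBridge — decomp-res lens-6 g29 §1: THE (T-bridge) CONSUMER (critic rows 205/206/210; 0-weight for lens-6,
releases lens-5's «IsoDict» MAP +1)

Host route `MaxContactCut` (route-ResolutionOfSingularities-o079-maxcontactcut), lens-6 column item
`stmt-ResolutionOfSingularities-26971`; lens-5 rider «IsoDict» (row 206, landed `Theorems/IsoDict`,
`Theorems/IsoDict2`, p820235 /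
p820313), lens-5 node «ThreadCut» §7 (landed `Theorems/ThreadCutJunction`), lens-6 node «RunCut» (landed
`Theorems/DeltaCutRun2`:
`BadThread`, `run`, `runPerpetual_iff_thread` = the kernel König).

THE BRIDGE, read at LEVEL 0 of lens-6's canonical bad run, in BOTH currencies at once and with NO transport: for `K` perfect of
characteristic `p`, `q = p^e`, `F ∈ K[u₁,…,uₙ]` with `ord₀ F ≥ q`, and the affine ROOT STAGE `N₀ = IsoDict.rootStage q F =
⟨Spec K[z,u], 𝓘(z^q + F)⟩` (lens-6's `Stage` letters), a BAD THREAD `T : BadThread q N₀` THROUGH THE ORIGIN (`T.pt 0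
= origin`) has its
level-0 point ISOLATED in the level-0 top locus `topLocusOf q (run q N₀ 0)` **iff** `F` is E-ISOLATED
(`TightDefectClasses.IsolatedTop q F`)
— lens-5's dictionary `IsoDict.isIsolatedIn_topLocusOf_rootStage_iff_isolatedTop` consumed BY NAME; lens-6's side is `rfl`
(`run q N₀ 0 = N₀` definitionally, `topLocusOf q (rootStage q F) = IsoDict.topLocus q F` =
`IsoDict.topLocusOf_rootStage`).  Then the
JUNCTION LETTER at level 0 in lens-5's §7 letters (`ThreadCut.EventuallyNonIsolated`, whose level-`i` set IS
`topLocusOf q (run q N i)` by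
`Iff.rfl`): over an E-ISOLATED head every eventually-non-isolated bad thread through the origin has its witness level `≥ 1` (the
lens-4 / lens-5 tower side: `WORTopRunPerpetualIso`'s habitat at level 0), and over a NON-E-isolated head the
thread's origin point is
already non-isolated at level 0 (ours: the `WORTopRunPerpetualNonIso` side is entered AT THE ROOT).  No second
König, no tower or chart of
`run` re-typed as a polynomial stage (lens-5's MAPPORT (P1)/(P2)/(P4) programme), no new cell, no aside.

Provenance: HOME = run/shared/lean/pub/decomp-res, lens-6 g29 (unit decomp-res-lens-6-g29) §1 of NEXT-g29 /
CRITIC-LEDGER row 210 §WINDOW;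
`--supports stmt-ResolutionOfSingularities-26971`; imports the LANDED `Theorems.IsoDict2` +
`Theorems.ThreadCutJunction` + `HarnessLib` only —
NO carry, every declaration new, namespace `…Theorems.DeltaCutClasses` (section `TBridge`).  (Sources: Hironaka1964
Ch. III §3 (Zariski–Nagata);
EGAIV4 Thm. 16.11.2; AtiyahMacdonald1969 Ch. 5 Thm. 5.11 (going-up); CossartJannsenSaito2020 Ch. 2, Ch. 8;
Hauser2010 §§C–G; König 1927 as Mathlib
`nonempty_sections_of_finite_inverse_system`.)
-/

/-! ## Provenance (writer g13)

Content VERBATIM from the decomp-res lens-6 g29 file `HOME/decomp-res-lens-6/g29/TBridge.lean` (sha256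
35c0c07a…06b2c5, 139 l; HOME = run/shared/lean/pub/decomp-res), the (T-bridge) CONSUMER of the row-206 MAP port:
`badThread_pt_isolated_iff_isolatedTop` (+ `_three`) — by-name consumer of the landed `IsoDict` / `IsoDict2` (lens-5
g33 «IsoDict», writer g13) and of `ThreadCutJunction`; level-0 junction letters
`one_le_of_nonIsolated_from` / `badThread_pt_zero_not_isolated_of_not_isolatedTop` /
`RunThreadsNonIsolated.one_le_witness` [PROVED].  Critic: CRITIC-LEDGER row 211 (l.278) — rider INBOX
2026-08-31T11:16:46Z: land verbatim as `Theorems/DeltaCutTBridge.lean`, `--kind proof --supports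
stmt-ResolutionOfSingularities-26971`, namespace `…Theorems.DeltaCutClasses` unchanged, the HOME-only
dupNamespace-linter line dropped (the library sets it), imports exactly as the node (landed `Theorems.IsoDict2` +
`Theorems.ThreadCutJunction` + `HarnessLib`).  Farm (lens + critic): rc 0 · 0 err · 0 warn · 0 sorry.
[WRITER NOTE (decomp-res writer g13): no declaration text changed; only the linter line removed and this provenance
block added.]
-/

set_option autoImplicit false

noncomputable section

open MvPolynomial AlgebraicGeometry
open Literature.AlgebraicGeometry.Resolution (idealOrder)
open Literature.AlgebraicGeometry.Resolution.Hauser2010 (ordZero)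
open Literature.AlgebraicGeometry.Hironaka2017.S02Preliminaries.CoordChart (origin)

open Summit.ResolutionOfSingularities.ResolutionOfSingularities.Theorems.ForcedTowerClasses (IsIsolatedIn)
open Summit.ResolutionOfSingularities.ResolutionOfSingularities.Theorems.TightDefectClasses (IsolatedTop)
open Summit.ResolutionOfSingularities.ResolutionOfSingularities.Theorems.IsoDict (hypZ rootStage topLocus topLocusOf_rootStage
  mem_topLocus_iff isIsolatedIn_topLocus_origin_iff_isolatedTop isIsolatedIn_topLocusOf_rootStage_iff_isolatedTop)
open Summit.ResolutionOfSingularities.ResolutionOfSingularities.Theorems.ThreadCut (EventuallyNonIsolated RunThreadsNonIsolated)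

namespace Summit.ResolutionOfSingularities.ResolutionOfSingularities.Theorems.DeltaCutClasses

section TBridge

variable {K : Type} [Field K] {n : ℕ}

/-! ### §TBridge — the (T-bridge) consumer at level 0 of the canonical bad run of the root stage -/

/-- lens-6's side of the bridge is `rfl`: the level-`0` stage of the canonical bad run of the root stage IS the root
stage, so its top
locus at marking `q` is lens-5's `IsoDict.topLocus q F` on `Spec K[z,u]`. [folklore] -/
theorem topLocusOf_run_rootStage_zero (q : ℕ) (F : MvPolynomial (Fin n) K) :
    topLocusOf q (run q (rootStage q F) 0) = topLocus q F := rfl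

/-- membership in the level-`0` top locus of the run of the root stage = symbolic `q`-foldness of `z^q + F`
(lens-5's `mem_topLocus_iff`,
BY NAME). [folklore] -/
theorem mem_topLocusOf_run_rootStage_zero_iff {q : ℕ} {F : MvPolynomial (Fin n) K}
    (y : ↥(run q (rootStage q F) 0).Y) :
    y ∈ topLocusOf q (run q (rootStage q F) 0) ↔
      hypZ q F ∈ Literature.AlgebraicGeometry.Resolution.HironakaScheme.symbPow K y.asIdeal q :=
  mem_topLocus_iff y

/-- lens-5's thread kind `ThreadCut.EventuallyNonIsolated` read in lens-6's letters: its level-`i` set IS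
`topLocusOf m (run m N i)`
(`Iff.rfl`; both are `{y | m ≤ idealOrder (run m N i).I y}`). [folklore] -/
theorem eventuallyNonIsolated_iff_topLocusOf {m : ℕ} {N : Stage} (T : BadThread m N) :
    EventuallyNonIsolated T ↔ ∃ i₀ : ℕ, ∀ i, i₀ ≤ i → ¬ IsIsolatedIn (topLocusOf m (run m N i)) (T.pt i) :=
  Iff.rfl

/-- **THE (T-bridge) CONSUMER** (critic rows 205/206/210, lens-5 rider «IsoDict» consumed BY NAME): for `K` perfect
of characteristic `p`,
`q = p^e`, `F ∈ K[u₁,…,uₙ]` with `ord₀ F ≥ q`, a BAD THREAD of lens-6's canonical bad run of the ROOT STAGE `⟨Spec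
K[z,u], 𝓘(z^q + F)⟩` passing
THROUGH THE ORIGIN at level `0` has its level-`0` point ISOLATED in the level-`0` top locus iff `F` is E-ISOLATED
(`TightDefectClasses.IsolatedTop`).
Proof: rewrite the point to the origin; the rest is `IsoDict.isIsolatedIn_topLocusOf_rootStage_iff_isolatedTop`
verbatim (`run q N₀ 0 = N₀` by `rfl`).
[DECIDED — PROVED] [folklore] -/
theorem badThread_pt_isolated_iff_isolatedTop [DecidableEq K] [PerfectField K] {p : ℕ} (hp : p.Prime) [CharP K p]
    (e : ℕ) (F : MvPolynomial (Fin n) K) (hF : ((p ^ e : ℕ) : ℕ∞) ≤ ordZero F)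
    (T : BadThread (p ^ e) (rootStage (p ^ e) F)) (h0 : T.pt 0 = origin K (Fin (n + 1))) :
    IsIsolatedIn (topLocusOf (p ^ e) (run (p ^ e) (rootStage (p ^ e) F) 0)) (T.pt 0) ↔ IsolatedTop (p ^ e) F := by
  rw [h0]
  exact isIsolatedIn_topLocusOf_rootStage_iff_isolatedTop hp e F hF

/-- The E-model instance `n = 3` (hypersurface `z^q + F(u₁,u₂,u₃)` in `𝔸⁴`, lens-6's dimension-four column; origin
of `Spec K[z,u₁,u₂,u₃]`).
[DECIDED — PROVED] [folklore] -/
theorem badThread_pt_isolated_iff_isolatedTop_three [DecidableEq K] [PerfectField K] {p : ℕ} (hp : p.Prime) [CharP K p]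
    (e : ℕ) (F : MvPolynomial (Fin 3) K) (hF : ((p ^ e : ℕ) : ℕ∞) ≤ ordZero F)
    (T : BadThread (p ^ e) (rootStage (p ^ e) F)) (h0 : T.pt 0 = origin K (Fin 4)) :
    IsIsolatedIn (topLocusOf (p ^ e) (run (p ^ e) (rootStage (p ^ e) F) 0)) (T.pt 0) ↔ IsolatedTop (p ^ e) F :=
  badThread_pt_isolated_iff_isolatedTop hp e F hF T h0

/-! ### The junction letter at level 0 (lens-5 §7 `EventuallyNonIsolated` / `RunThreadsNonIsolated`; lens-4/lens-5
towers = the ISOLATED side) -/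

/-- **JUNCTION LETTER, E-ISOLATED HEAD** (the lens-4 / lens-5 tower side at the root): over an E-isolated head, a
bad thread through the
origin that is non-isolated in the top locus from level `i₀` on has `1 ≤ i₀` — at level `0` its point IS isolated;
non-isolation can only
begin at levels `≥ 1` (where lens-5's chart dictionary MAPPORT (P1)/(P2) takes over). [DECIDED — PROVED] [folklore] -/
theorem one_le_of_nonIsolated_from [DecidableEq K] [PerfectField K] {p : ℕ} (hp : p.Prime) [CharP K p]
    (e : ℕ) (F : MvPolynomial (Fin n) K) (hF : ((p ^ e : ℕ) : ℕ∞) ≤ ordZero F) (hiso : IsolatedTop (p ^ e) F)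
    (T : BadThread (p ^ e) (rootStage (p ^ e) F)) (h0 : T.pt 0 = origin K (Fin (n + 1))) {i₀ : ℕ}
    (hni : ∀ i, i₀ ≤ i → ¬ IsIsolatedIn (topLocusOf (p ^ e) (run (p ^ e) (rootStage (p ^ e) F) i)) (T.pt i)) :
    1 ≤ i₀ := by
  rcases Nat.eq_zero_or_pos i₀ with h | h
  · subst h
    exact absurd ((badThread_pt_isolated_iff_isolatedTop hp e F hF T h0).mpr hiso) (hni 0 le_rfl)
  · exact h

/-- the same in lens-5's letter `EventuallyNonIsolated`: over an E-isolated head, an eventually-non-isolated bad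
thread through the origin
has every admissible witness level `≥ 1`; in particular the thread is NOT «non-isolated from level 0». [DECIDED —
PROVED] [folklore] -/
theorem not_nonIsolated_from_zero_of_isolatedTop [DecidableEq K] [PerfectField K] {p : ℕ} (hp : p.Prime) [CharP K p]
    (e : ℕ) (F : MvPolynomial (Fin n) K) (hF : ((p ^ e : ℕ) : ℕ∞) ≤ ordZero F) (hiso : IsolatedTop (p ^ e) F)
    (T : BadThread (p ^ e) (rootStage (p ^ e) F)) (h0 : T.pt 0 = origin K (Fin (n + 1))) :
    ¬ ∀ i, 0 ≤ i → ¬ IsIsolatedIn (topLocusOf (p ^ e) (run (p ^ e) (rootStage (p ^ e) F) i)) (T.pt i) :=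
  fun h => Nat.not_succ_le_zero 0 (one_le_of_nonIsolated_from hp e F hF hiso T h0 h)

/-- **JUNCTION LETTER, NON-E-ISOLATED HEAD** (ours — the `WORTopRunPerpetualNonIso` side is entered AT THE ROOT):
over a head that is NOT
E-isolated, a bad thread through the origin is NON-isolated in the top locus already at level `0`, hence
`EventuallyNonIsolated` with witness
level `0` as soon as it is non-isolated at every later level too. [DECIDED — PROVED] [folklore] -/
theorem badThread_pt_zero_not_isolated_of_not_isolatedTop [DecidableEq K] [PerfectField K] {p : ℕ} (hp : p.Prime) [CharP K p]
    (e : ℕ) (F : MvPolynomial (Fin n) K) (hF : ((p ^ e : ℕ) : ℕ∞) ≤ ordZero F) (hnot : ¬ IsolatedTop (p ^ e) F)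
    (T : BadThread (p ^ e) (rootStage (p ^ e) F)) (h0 : T.pt 0 = origin K (Fin (n + 1))) :
    ¬ IsIsolatedIn (topLocusOf (p ^ e) (run (p ^ e) (rootStage (p ^ e) F) 0)) (T.pt 0) :=
  fun h => hnot ((badThread_pt_isolated_iff_isolatedTop hp e F hF T h0).mp h)

/-- lens-5's datum kind `RunThreadsNonIsolated` forces, over an E-ISOLATED head, every bad thread through the origin
to become non-isolated
only at a level `≥ 1` (restatement of `one_le_of_nonIsolated_from` for the kind's witness). [DECIDED — PROVED] [folklore] -/
theorem RunThreadsNonIsolated.one_le_witness [DecidableEq K] [PerfectField K] {p : ℕ} (hp : p.Prime) [CharP K p]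
    (e : ℕ) (F : MvPolynomial (Fin n) K) (hF : ((p ^ e : ℕ) : ℕ∞) ≤ ordZero F) (hiso : IsolatedTop (p ^ e) F)
    (hR : RunThreadsNonIsolated (p ^ e) (rootStage (p ^ e) F))
    (T : BadThread (p ^ e) (rootStage (p ^ e) F)) (h0 : T.pt 0 = origin K (Fin (n + 1))) :
    ∃ i₀ : ℕ, 1 ≤ i₀ ∧ ∀ i, i₀ ≤ i → ¬ IsIsolatedIn (topLocusOf (p ^ e) (run (p ^ e) (rootStage (p ^ e) F) i)) (T.pt i) := by
  obtain ⟨i₀, hi₀⟩ := (eventuallyNonIsolated_iff_topLocusOf T).mp (hR T)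
  exact ⟨i₀, one_le_of_nonIsolated_from hp e F hF hiso T h0 hi₀, hi₀⟩

end TBridge

end Summit.ResolutionOfSingularities.ResolutionOfSingularities.Theorems.DeltaCutClasses
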